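import Mathlib
import HarnessLib
import Summits.NavierStokesRegularity.NavierStokesRegularity.Theorems.PoloidalWindowDoorLrcModEntireTwistingTHFlatRidgeArcForm

/-!
# Item `LrcModEntire` (stmt-NavierStokesRegularity-20428) — THE FLAT SUB-CELL ALONG A HOT ARC: the space–time (§17d) quartic pin with the TANGENT kernel, uniformly along the arc

ns-k2-port-2 g7, helper of item 20428 (LEAD lineage ns-poloidal-K2-p3; `--supports stmt-NavierStokesRegularity-20428 --as helper`).  Memo `Cruxes/LrcModEntire/T2B-g15.md` §17d.
`…FlatRidgeSecantPin.secantQuarticPin_of_flatHotPoint` gives the branch-free pin `72ρ₀²q ≤ 3N/4 − σθ_tt` for SOME unit horizontal `ν` (the normal of a limit secant) and SOME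
`ρ₀ ≥ 1`.  Along a differentiable hot arc `γ ⊂ P₀` the kernel direction is the TANGENT (`…FlatRidgeArcForm.tangentKernel_of_hotArc`), so the pin holds with `ν(s) = Jγ′(s)`,
i.e. for the SAME transversal quartic coefficient `P(s) = ∂_ν⁴θ(γ s)` that enters the arc package `…FlatRidgeArcForm` / `…FlatRidgeArcDefinite`:

* `kernelQuarticTimePin_of_flatHotPoint` — flat-cell binders, a flat hot point `y`, a unit horizontal kernel direction `T`, `ν = JT`, `P = D⁴θ(y)[ν,ν,ν,ν]` (fourth-derivative
  currency) ⇒ `∃ ρ₀ ≥ 1, 3ρ₀²·(−σP) ≤ 3|N|/4 − σθ_tt(y)` (same proof as the secant pin, kernel supplied);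
* ★ `arcQuarticTimePin_of_flatHotArc` — along a differentiable unit-speed hot arc: for every `s`, with `T = deriv γ s`, `y = γ s`:
  `∃ ρ₀ ≥ 1, 3ρ₀²(−σP(s)) ≤ 3|N|/4 − σθ_tt(γ s)`, hence the `ρ₀`-free **`3(−σP(s)) ≤ 3|N|/4 − σθ_tt(γ s)`**, i.e. `q(s) = −σP(s)/24 ≤ (|N|/4 − σθ_tt(γ s)/3)/24`:
  the transversal quartic datum of the arc is controlled by the time–time slack at every arc point (with `…ArcDefinite`: `m(s) ≤ c₀²(−σP(s))/24`).

WHAT THIS IS NOT: not a claim about Navier–Stokes regularity and not a proof of `stub_T2bFlat` (bears_on LADDER-NS N0, item 20428 / crux 19708; OPEN).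
-/

set_option linter.style.longLine false
set_option linter.dupNamespace false

namespace Summit.NavierStokesRegularity.NavierStokesRegularity.Theorems.PoloidalWindowDoorLrcModEntireTwistingTHFlatRidgeArcTimePin

open Set Function Filter Topology Metric
open scoped RealInnerProductSpace InnerProductSpace ContDiff Laplacian
open Literature.Analysis Literature.Analysis.FluidPDE Literature.Analysis.UnboundedOperators
open Summit.NavierStokesRegularity.NavierStokesRegularity.Theorems
open Summit.NavierStokesRegularity.NavierStokesRegularity.Theorems.LocalSineTubeDoorProfileAlignedWindowRigidityAncient
open Summit.NavierStokesRegularity.NavierStokesRegularity.Theorems.PoloidalWindowDoorPoloidalWindowRigidityWindow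
open Summit.NavierStokesRegularity.NavierStokesRegularity.Theorems.PoloidalWindowDoorLrcModEntireRidgeWiring
open Summit.NavierStokesRegularity.NavierStokesRegularity.Theorems.PoloidalWindowDoorLrcModEntireQuarticMax
open Summit.NavierStokesRegularity.NavierStokesRegularity.Theorems.PoloidalWindowDoorLrcModEntireTwistingTHFlatRidgeJet
open Summit.NavierStokesRegularity.NavierStokesRegularity.Theorems.PoloidalWindowDoorLrcModEntireTwistingTHFlatRidgeThirdJet
open Summit.NavierStokesRegularity.NavierStokesRegularity.Theorems.PoloidalWindowDoorLrcModEntireTwistingTHFlatRidgeMixedPin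
open Summit.NavierStokesRegularity.NavierStokesRegularity.Theorems.PoloidalWindowDoorLrcModEntireTwistingTHFlatRidgeQuarticLawTools
open Summit.NavierStokesRegularity.NavierStokesRegularity.Theorems.PoloidalWindowDoorLrcModEntireTwistingTHFlatRidgeQuarticPin
open Summit.NavierStokesRegularity.NavierStokesRegularity.Theorems.PoloidalWindowDoorLrcModEntireTwistingTHFlatRidgeQuarticLaw
open Summit.NavierStokesRegularity.NavierStokesRegularity.Theorems.PoloidalWindowDoorLrcModEntireTwistingTHFlatRidgeSecantPin
open Summit.NavierStokesRegularity.NavierStokesRegularity.Theorems.PoloidalWindowDoorLrcModEntireTwistingTHFlatRidgeQuarticForm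
open Summit.NavierStokesRegularity.NavierStokesRegularity.Theorems.PoloidalWindowDoorLrcModEntireTwistingTHFlatRidgeArcForm

variable {C : ℝ} {v : ℝ → EuclideanSpace ℝ (Fin 3) → EuclideanSpace ℝ (Fin 3)}

/-- **THE §17d SPACE–TIME QUARTIC PIN FOR A GIVEN KERNEL DIRECTION** (fourth-derivative currency): flat-cell binders, a flat hot point `y ∈ P₀`, a unit horizontal `T` with
`D⁴θ(y)[T,w,a,b] = 0` ⇒ with `ν = JT`, `P = D⁴θ(y)[ν,ν,ν,ν]`: `∃ ρ₀ ≥ 1, 3ρ₀²(−σP) ≤ 3|N|/4 − σ∂ₜ²v₂(·,y)(−1)`.  (Proof of `…SecantPin.secantQuarticPin_of_flatHotPoint` with the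
kernel supplied instead of constructed.) -/
theorem kernelQuarticTimePin_of_flatHotPoint (hdec : HasTypeITimeDecay C v) (hcont : ContinuousOn (uncurry v) (Iio (0 : ℝ) ×ˢ univ))
    (hmild : ∀ s t : ℝ, s < t → t < 0 → ∀ x, v t x = heatExtension (v s) (t - s) x - oseenDuhamel 1 s v v t x)
    (hdiv : ∀ t < 0, VectorCalculus.IsDivFree (v t))
    (hpol : ∀ s < 0, ∀ y, ⟪curl (v s) y, EuclideanSpace.single 2 1⟫_ℝ = 0)
    (hTH : ∀ t < 0, ∀ x x' : EuclideanSpace ℝ (Fin 3), x 2 = x' 2 → ∀ b c : Fin 3, b ≠ 2 → c ≠ 2 →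
      fderiv ℝ (v t) x (EuclideanSpace.single 2 1) b * fderiv ℝ (v t) x' (EuclideanSpace.single c 1) 2 =
        fderiv ℝ (v t) x' (EuclideanSpace.single 2 1) c * fderiv ℝ (v t) x (EuclideanSpace.single b 1) 2)
    (hne : v (-1) 0 2 ≠ 0) (hhot : ∀ t < 0, ∀ x, Real.sqrt (-t) * |v t x 2| ≤ |v (-1) 0 2|)
    (hproper : ∀ y ∈ {y : EuclideanSpace ℝ (Fin 3) | y 2 = 0 ∧ v (-1) y 2 = v (-1) 0 2}, ∀ r : ℝ, 0 < r →
      ∃ y' : EuclideanSpace ℝ (Fin 3), y' 2 = 0 ∧ dist y' y < r ∧ v (-1) y' 2 ≠ v (-1) 0 2)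
    {σ : ℝ} (hσN : σ * v (-1) 0 2 = |v (-1) 0 2|)
    (hflatAll : ∀ y : EuclideanSpace ℝ (Fin 3), y 2 = 0 → v (-1) y 2 = v (-1) 0 2 →
      fderiv ℝ (fderiv ℝ (fun x => σ * v (-1) x 2)) y (EuclideanSpace.single 0 1) (EuclideanSpace.single 0 1) +
        fderiv ℝ (fderiv ℝ (fun x => σ * v (-1) x 2)) y (EuclideanSpace.single 1 1) (EuclideanSpace.single 1 1) = 0)
    {y : EuclideanSpace ℝ (Fin 3)} (hy0 : y 2 = 0) (hy : v (-1) y 2 = v (-1) 0 2)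
    {T : EuclideanSpace ℝ (Fin 3)} (hT2 : T 2 = 0) (hT1 : ‖T‖ = 1)
    (hker : ∀ a b w : EuclideanSpace ℝ (Fin 3), fderiv ℝ (fderiv ℝ (fun x => fderiv ℝ (fderiv ℝ (fun x' => (v (-1) x' 2 : ℝ))) x a b)) y T w = 0) :
    ∃ ρ₀ : ℝ, 1 ≤ ρ₀ ∧
      3 * ρ₀ ^ 2 * (-(σ * fderiv ℝ (fderiv ℝ (fun x => fderiv ℝ (fderiv ℝ (fun x' => (v (-1) x' 2 : ℝ))) x ((-T 1) • EuclideanSpace.single 0 (1 : ℝ) + T 0 • EuclideanSpace.single 1 (1 : ℝ)) ((-T 1) • EuclideanSpace.single 0 (1 : ℝ) + T 0 • EuclideanSpace.single 1 (1 : ℝ)))) y ((-T 1) • EuclideanSpace.single 0 (1 : ℝ) + T 0 • EuclideanSpace.single 1 (1 : ℝ)) ((-T 1) • EuclideanSpace.single 0 (1 : ℝ) + T 0 • EuclideanSpace.single 1 (1 : ℝ)))) ≤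
        3 * |v (-1) 0 2| / 4 - σ * deriv (deriv (fun s => v s y 2)) (-1) := by
  set θ : EuclideanSpace ℝ (Fin 3) → ℝ := fun x => v (-1) x 2 with hθdef
  have hθ : ContDiff ℝ 4 θ := contDiff_two_component hdec hcont hmild
  have hflat := hflatAll y hy0 hy
  set ν : EuclideanSpace ℝ (Fin 3) := (-T 1) • EuclideanSpace.single 0 (1 : ℝ) + T 0 • EuclideanSpace.single 1 (1 : ℝ) with hνdef
  have hν0 : ν 0 = -T 1 := by simp [hνdef]
  have hν1' : ν 1 = T 0 := by simp [hνdef]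
  have hν2 : ν 2 = 0 := by simp [hνdef]
  have hν1 : ‖ν‖ = 1 := by
    have h := EuclideanSpace.norm_eq T
    rw [EuclideanSpace.norm_eq ν, ← hT1, h]
    congr 1
    simp only [Fin.sum_univ_three, Real.norm_eq_abs, sq_abs, hν0, hν1', hν2, hT2]
    ring
  obtain ⟨ρ₀, hρ₀, hpin⟩ := quarticSliceTimePin_of_flatHotPoint hdec hcont hmild hdiv hpol hTH hne hhot hproper hσN hy0 hy hflat hν2
  refine ⟨ρ₀, hρ₀, ?_⟩
  -- ## the horizontal trace of `D²(D²θ)(y)[ν,ν]` is the pure fourth derivative `∂_ν⁴θ(y)`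
  -- the function `Δₕθ = H_{e₀e₀} + H_{e₁e₁} = H_{νν} + H_{TT}` pointwise
  have hf2 : ContDiff ℝ 2 θ := hθ.of_le (by norm_num)
  have htrace : (fun x => fderiv ℝ (fun x' => fderiv ℝ θ x' (EuclideanSpace.single 0 1)) x (EuclideanSpace.single 0 1) +
        fderiv ℝ (fun x' => fderiv ℝ θ x' (EuclideanSpace.single 1 1)) x (EuclideanSpace.single 1 1)) =
      fun x => fderiv ℝ (fderiv ℝ θ) x ν ν + fderiv ℝ (fderiv ℝ θ) x T T := by
    funext x
    rw [← fderiv_fderiv_eq_coord hf2 x, ← fderiv_fderiv_eq_coord hf2 x]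
    exact horizTrace_eq (fderiv ℝ (fderiv ℝ θ) x) hT2 hT1
  have hHνν : ContDiff ℝ 2 (fun x => fderiv ℝ (fderiv ℝ θ) x ν ν) := contDiff_hessianEntry hθ ν ν
  have hHTT : ContDiff ℝ 2 (fun x => fderiv ℝ (fderiv ℝ θ) x T T) := contDiff_hessianEntry hθ T T
  have hsplit : fderiv ℝ (fderiv ℝ (fun x => fderiv ℝ (fun x' => fderiv ℝ θ x' (EuclideanSpace.single 0 1)) x (EuclideanSpace.single 0 1) +
        fderiv ℝ (fun x' => fderiv ℝ θ x' (EuclideanSpace.single 1 1)) x (EuclideanSpace.single 1 1))) y ν ν =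
      fderiv ℝ (fderiv ℝ (fun x => fderiv ℝ (fderiv ℝ θ) x ν ν)) y ν ν := by
    rw [htrace]
    have hd1 : ∀ x, DifferentiableAt ℝ (fun x => fderiv ℝ (fderiv ℝ θ) x ν ν) x := fun x => (hHνν.differentiable (by norm_num)) x
    have hd2 : ∀ x, DifferentiableAt ℝ (fun x => fderiv ℝ (fderiv ℝ θ) x T T) x := fun x => (hHTT.differentiable (by norm_num)) x
    have e1 : fderiv ℝ (fun x => fderiv ℝ (fderiv ℝ θ) x ν ν + fderiv ℝ (fderiv ℝ θ) x T T) =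
        fderiv ℝ (fun x => fderiv ℝ (fderiv ℝ θ) x ν ν) + fderiv ℝ (fun x => fderiv ℝ (fderiv ℝ θ) x T T) := by
      funext x; exact fderiv_fun_add (hd1 x) (hd2 x)
    have hD1 : DifferentiableAt ℝ (fderiv ℝ (fun x => fderiv ℝ (fderiv ℝ θ) x ν ν)) y :=
      ((hHνν.fderiv_right (m := 1) (by norm_num)).differentiable one_ne_zero) y
    have hD2 : DifferentiableAt ℝ (fderiv ℝ (fun x => fderiv ℝ (fderiv ℝ θ) x T T)) y :=
      ((hHTT.fderiv_right (m := 1) (by norm_num)).differentiable one_ne_zero) y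
    rw [e1, fderiv_add hD1 hD2]
    simp only [add_apply]
    -- the `T`-term vanishes: `D⁴θ(y)[ν,ν,T,T] = D⁴θ(y)[T,ν,ν,T] = 0`
    have hTT : fderiv ℝ (fderiv ℝ (fun x => fderiv ℝ (fderiv ℝ θ) x T T)) y ν ν = 0 := by
      rw [fourthDeriv_symm_middle hθ T T ν ν, fourthDeriv_symm_outer hθ ν T ν T]
      exact hker ν T ν
    rw [hTT, add_zero]
  -- ## `∂_ν⁴θ(y)` as an iterated line derivative
  have hline4 : iteratedDeriv 4 (fun n : ℝ => v (-1) (y + n • ν) 2) 0 = fderiv ℝ (fderiv ℝ (fun x => fderiv ℝ (fderiv ℝ θ) x ν ν)) y ν ν := by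
    -- second line derivative as a function of the base point: `d²/dn² θ(y + nν)|ₛ = D²θ(y + sν)[ν,ν]`
    have hℓ2 : iteratedDeriv 2 (fun n : ℝ => v (-1) (y + n • ν) 2) = fun s => fderiv ℝ (fderiv ℝ θ) (y + s • ν) ν ν := by
      funext s
      have hshift := congrFun (iteratedDeriv_comp_const_add 2 (fun n : ℝ => v (-1) (y + n • ν) 2) s) 0
      rw [add_zero] at hshift
      rw [← hshift]
      have e : (fun z : ℝ => (fun n : ℝ => v (-1) (y + n • ν) 2) (s + z)) = fun z : ℝ => θ ((y + s • ν) + z • ν) := by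
        funext z
        show v (-1) (y + (s + z) • ν) 2 = v (-1) (y + s • ν + z • ν) 2
        rw [add_smul, add_assoc]
      rw [e, iteratedDeriv_two_line_apply hf2 (y + s • ν) ν]
    have e4 : iteratedDeriv 4 (fun n : ℝ => v (-1) (y + n • ν) 2) 0 = iteratedDeriv 2 (iteratedDeriv 2 (fun n : ℝ => v (-1) (y + n • ν) 2)) 0 := by
      simp only [iteratedDeriv_eq_iterate]
      rw [show (4 : ℕ) = 2 + 2 from rfl, Function.iterate_add_apply]
    rw [e4, hℓ2, iteratedDeriv_two_line_apply hHνν y ν]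
  -- ## conclude (fourth-derivative currency)
  rw [hsplit, hline4] at hpin
  have hQ := quarticSign_of_flatHotPoint hdec hcont hmild hdiv hTH hne hhot hproper hσN hy0 hy hflat ν
  rw [hline4] at hQ
  have hA : σ * deriv (deriv (fun s => v s y 2)) (-1) ≤ 3 * |v (-1) 0 2| / 4 := timeTimePin_of_hotPoint hdec hcont hmild hne hhot hσN hy
  have hσ2 : σ ^ 2 = 1 := by
    have h := abs_sigma_eq_one hne hσN
    have := sq_abs σ; rw [h] at this; linarith
  rw [hθdef] at hpin hQ
  obtain ⟨Q, hQdef⟩ : ∃ Q : ℝ, Q = fderiv ℝ (fderiv ℝ (fun x => fderiv ℝ (fderiv ℝ (fun x' => (v (-1) x' 2 : ℝ))) x ν ν)) y ν ν := ⟨_, rfl⟩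
  obtain ⟨M, hMdef⟩ : ∃ M : ℝ, M = 3 * |v (-1) 0 2| / 4 - σ * deriv (deriv (fun s => v s y 2)) (-1) := ⟨_, rfl⟩
  rw [← hQdef] at hpin hQ ⊢
  rw [← hMdef]
  have hM : 0 ≤ M := by rw [hMdef]; linarith only [hA]
  have hP : 0 ≤ -(σ * Q) := by linarith only [hQ]
  have key : 3 * ρ₀ ^ 2 * (-(σ * Q)) * (-(σ * Q)) ≤ M * (-(σ * Q)) := by
    have e1 : 3 * ρ₀ ^ 2 * (-(σ * Q)) * (-(σ * Q)) = 3 * (ρ₀ * Q) ^ 2 := by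
      have : σ ^ 2 * Q ^ 2 = Q ^ 2 := by rw [hσ2, one_mul]
      nlinarith only [this]
    have e2 : M * (-(σ * Q)) = (σ * deriv (deriv (fun s => v s y 2)) (-1) - 3 * |v (-1) 0 2| / 4) * (σ * Q) := by rw [hMdef]; ring
    rw [e1, e2]
    exact hpin
  rcases hP.eq_or_lt with hP0 | hPpos
  · rw [← hP0, mul_zero]; exact hM
  · exact le_of_mul_le_mul_right key hPpos

/-- ★ **THE §17d PIN ALONG A HOT ARC, WITH THE TANGENT KERNEL.**  Flat-cell binders VERBATIM and a differentiable unit-speed hot arc `γ ⊂ P₀`: for every `s`, with `T = deriv γ s`,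
`ν = JT`, `y = γ s`, `P(s) = D⁴θ(y)[ν,ν,ν,ν]`: `∃ ρ₀ ≥ 1, 3ρ₀²(−σP(s)) ≤ 3|N|/4 − σθ_tt(γ s)`, and the `ρ₀`-free consequence `3(−σP(s)) ≤ 3|N|/4 − σθ_tt(γ s)`. -/
theorem arcQuarticTimePin_of_flatHotArc (hdec : HasTypeITimeDecay C v) (hcont : ContinuousOn (uncurry v) (Iio (0 : ℝ) ×ˢ univ))
    (hmild : ∀ s t : ℝ, s < t → t < 0 → ∀ x, v t x = heatExtension (v s) (t - s) x - oseenDuhamel 1 s v v t x)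
    (hdiv : ∀ t < 0, VectorCalculus.IsDivFree (v t))
    (hpol : ∀ s < 0, ∀ y, ⟪curl (v s) y, EuclideanSpace.single 2 1⟫_ℝ = 0)
    (hTH : ∀ t < 0, ∀ x x' : EuclideanSpace ℝ (Fin 3), x 2 = x' 2 → ∀ b c : Fin 3, b ≠ 2 → c ≠ 2 →
      fderiv ℝ (v t) x (EuclideanSpace.single 2 1) b * fderiv ℝ (v t) x' (EuclideanSpace.single c 1) 2 =
        fderiv ℝ (v t) x' (EuclideanSpace.single 2 1) c * fderiv ℝ (v t) x (EuclideanSpace.single b 1) 2)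
    (hne : v (-1) 0 2 ≠ 0) (hhot : ∀ t < 0, ∀ x, Real.sqrt (-t) * |v t x 2| ≤ |v (-1) 0 2|)
    (hproper : ∀ y ∈ {y : EuclideanSpace ℝ (Fin 3) | y 2 = 0 ∧ v (-1) y 2 = v (-1) 0 2}, ∀ r : ℝ, 0 < r →
      ∃ y' : EuclideanSpace ℝ (Fin 3), y' 2 = 0 ∧ dist y' y < r ∧ v (-1) y' 2 ≠ v (-1) 0 2)
    {σ : ℝ} (hσN : σ * v (-1) 0 2 = |v (-1) 0 2|)
    (hflatAll : ∀ y : EuclideanSpace ℝ (Fin 3), y 2 = 0 → v (-1) y 2 = v (-1) 0 2 →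
      fderiv ℝ (fderiv ℝ (fun x => σ * v (-1) x 2)) y (EuclideanSpace.single 0 1) (EuclideanSpace.single 0 1) +
        fderiv ℝ (fderiv ℝ (fun x => σ * v (-1) x 2)) y (EuclideanSpace.single 1 1) (EuclideanSpace.single 1 1) = 0)
    {γ : ℝ → EuclideanSpace ℝ (Fin 3)} (hγd : Differentiable ℝ γ) (hγ2 : ∀ s, γ s 2 = 0) (hγv : ∀ s, v (-1) (γ s) 2 = v (-1) 0 2)
    (hunit : ∀ s, ‖deriv γ s‖ = 1) (s : ℝ) (T : EuclideanSpace ℝ (Fin 3)) (hT : T = deriv γ s) (y : EuclideanSpace ℝ (Fin 3)) (hyγ : y = γ s) :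
    (∃ ρ₀ : ℝ, 1 ≤ ρ₀ ∧
      3 * ρ₀ ^ 2 * (-(σ * fderiv ℝ (fderiv ℝ (fun x => fderiv ℝ (fderiv ℝ (fun x' => (v (-1) x' 2 : ℝ))) x ((-T 1) • EuclideanSpace.single 0 (1 : ℝ) + T 0 • EuclideanSpace.single 1 (1 : ℝ)) ((-T 1) • EuclideanSpace.single 0 (1 : ℝ) + T 0 • EuclideanSpace.single 1 (1 : ℝ)))) y ((-T 1) • EuclideanSpace.single 0 (1 : ℝ) + T 0 • EuclideanSpace.single 1 (1 : ℝ)) ((-T 1) • EuclideanSpace.single 0 (1 : ℝ) + T 0 • EuclideanSpace.single 1 (1 : ℝ)))) ≤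
        3 * |v (-1) 0 2| / 4 - σ * deriv (deriv (fun s' => v s' y 2)) (-1)) ∧
    3 * (-(σ * fderiv ℝ (fderiv ℝ (fun x => fderiv ℝ (fderiv ℝ (fun x' => (v (-1) x' 2 : ℝ))) x ((-T 1) • EuclideanSpace.single 0 (1 : ℝ) + T 0 • EuclideanSpace.single 1 (1 : ℝ)) ((-T 1) • EuclideanSpace.single 0 (1 : ℝ) + T 0 • EuclideanSpace.single 1 (1 : ℝ)))) y ((-T 1) • EuclideanSpace.single 0 (1 : ℝ) + T 0 • EuclideanSpace.single 1 (1 : ℝ)) ((-T 1) • EuclideanSpace.single 0 (1 : ℝ) + T 0 • EuclideanSpace.single 1 (1 : ℝ)))) ≤ 3 * |v (-1) 0 2| / 4 - σ * deriv (deriv (fun s' => v s' y 2)) (-1) := by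
  subst hT
  subst hyγ
  have hy0 : γ s 2 = 0 := hγ2 s
  have hy : v (-1) (γ s) 2 = v (-1) 0 2 := hγv s
  have hT1 : ‖deriv γ s‖ = 1 := hunit s
  have hT0 : deriv γ s ≠ 0 := by
    intro h; rw [h, norm_zero] at hT1; exact zero_ne_one hT1
  have hT2 : deriv γ s 2 = 0 := by
    have hd : HasDerivAt (fun s' => γ s' 2) (deriv γ s 2) s :=
      (EuclideanSpace.proj (𝕜 := ℝ) (2 : Fin 3)).hasFDerivAt.comp_hasDerivAt s (hγd s).hasDerivAt
    have hc : (fun s' => γ s' 2) = fun _ => (0 : ℝ) := funext fun s' => hγ2 s'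
    rw [hc] at hd
    rw [← hd.deriv, deriv_const]
  have hker : ∀ a b w : EuclideanSpace ℝ (Fin 3),
      fderiv ℝ (fderiv ℝ (fun x => fderiv ℝ (fderiv ℝ (fun x' => (v (-1) x' 2 : ℝ))) x a b)) (γ s) (deriv γ s) w = 0 := fun a b w =>
    tangentKernel_of_hotArc hdec hcont hmild hdiv hTH hne hhot hproper hσN hflatAll hγ2 hγv (hγd s).hasDerivAt hT0 a b w
  obtain ⟨ρ₀, hρ₀, hpin⟩ := kernelQuarticTimePin_of_flatHotPoint hdec hcont hmild hdiv hpol hTH hne hhot hproper hσN hflatAll hy0 hy hT2 hT1 hker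
  refine ⟨⟨ρ₀, hρ₀, hpin⟩, ?_⟩
  -- drop `ρ₀ ≥ 1`: `−σP ≥ 0` by the quartic sign
  have hsign := fourthDeriv_diag_nonpos_of_flatHotPoint hdec hcont hmild hdiv hTH hne hhot hproper hσN hy0 hy (hflatAll _ hy0 hy)
    ((-(deriv γ s) 1) • EuclideanSpace.single 0 (1 : ℝ) + (deriv γ s) 0 • EuclideanSpace.single 1 (1 : ℝ))
  have hP : 0 ≤ -(σ * fderiv ℝ (fderiv ℝ (fun x => fderiv ℝ (fderiv ℝ (fun x' => (v (-1) x' 2 : ℝ))) x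
      ((-(deriv γ s) 1) • EuclideanSpace.single 0 (1 : ℝ) + (deriv γ s) 0 • EuclideanSpace.single 1 (1 : ℝ))
      ((-(deriv γ s) 1) • EuclideanSpace.single 0 (1 : ℝ) + (deriv γ s) 0 • EuclideanSpace.single 1 (1 : ℝ)))) (γ s)
      ((-(deriv γ s) 1) • EuclideanSpace.single 0 (1 : ℝ) + (deriv γ s) 0 • EuclideanSpace.single 1 (1 : ℝ))
      ((-(deriv γ s) 1) • EuclideanSpace.single 0 (1 : ℝ) + (deriv γ s) 0 • EuclideanSpace.single 1 (1 : ℝ))) := by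
    linarith [hsign]
  have hρ2 : 1 ≤ ρ₀ ^ 2 := by nlinarith [hρ₀]
  nlinarith [hpin, hP, hρ2]

end Summit.NavierStokesRegularity.NavierStokesRegularity.Theorems.PoloidalWindowDoorLrcModEntireTwistingTHFlatRidgeArcTimePin
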